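import Summits.AtomisticToContinuum.Crystallization.Theorems.ChartedZeroExcessLayeredLatticeLiouvilleZZZYOA

/-!
# ChartedZeroExcess · LayeredLatticeLiouville ZZZYO (lens-2 g96 NODE 96b «Davidenko») — the local step (LSᴸ) from the LINEAR response bound

Docket `stmt-AtomisticToContinuum-26636`, W2 residual of record (critic r1663): (X1ᴸ′) ∧ (X2ᴸ′) ∧ (KAᴸ′) ∧ (QL♯ᴸ′)(c > 0) ∧ (OGʰ′⋆)(g₀ > 0)
⟹ `[MCMC♮]` (door W2m, tree ZZZYM).  NODE 96 (ZZZYN): (X2ᴸ′) ⟸ (X1ᴸ′)(lam > 0) ∧ (LSᴸ) `LabelLoadStepP` (march, PROVED; door W2n), with the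
linear piece (GRᴸ) `LabelGreenResponseP` typed but not wired.  THIS FILE WIRES IT: the lens cut «special (convexity) vs generic (regularity)» one
level down —

  (LSᴸ)(η•, h)  ⟸  (X1ᴸ′)(lam > 0)  ∧  (REGᴸ) `LabelRegularityP`  ∧  (GRᴸ)(Γ•)   whenever `Γ•·h < η•`   (`labelLoadStepP_of_greenResponse`, PROVED),

by the load ramp of ZZZYOA (Davidenko ODE `z′ = H(z)⁻¹ψ` in the tube gauge).  What each piece supplies: (X1ᴸ′) first-order strong convexity on the
OUTER tube ⟹ the Fréchet Hessian is COERCIVE hence INVERTIBLE between the tubes (`hessian_coercive_of_strongConvexOn`: add the two convexity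
inequalities at `x` and `x + τv`, divide by `τ`, `τ → 0⁺` — gradient monotonicity, no second-order Taylor; `exists_dualEquiv_eq_of_injective`:
dimension count); (REGᴸ) the qualitative `C²` Fréchet structure of the clamped energy between the tubes and the identification of its polarised
Hessian with the tree's `clampedHessForm` [ROUTINE]; (GRᴸ)(Γ•) the UNIFORM STRUCTURED linear response bound over the inner tube [LINEAR ·
CERTIFICATE-class · the object of desk line E2].  Consequently the a-priori piece of the residual reads

  (X2ᴸ′)  ⟸  (X1ᴸ′) ∧ (REGᴸ) ∧ (GRᴸ)(Γ• < •₁)      — door `mildCoherentMoatCorePG_W2o` (Archimedes picks the number of steps),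

i.e. the ONLY quantitative input left under (X2ᴸ′) is the linear response gauge `Γ•` being STRICTLY INSIDE the inner radii `•₁` (E2: `Γb ≤ 1.5·10⁻³`
adversarial vs `sb₁ = 1/400`, margin `1.7`).  No generic `∞→∞` Green bound (fails ×17–50, E2-FULL), no Hessian–Lipschitz constant, no step size.

* §1  `hessian_coercive_of_strongConvexOn`, `exists_dualEquiv_eq_of_injective` (PROVED, abstract);
* §2  the gauge set `tubeGauge X Rg Γb ΓI ΓB y₀` of tube increments and its bookkeeping (convex, closed, `0 ∈`, monotone, homogeneous, step, ball);
* §3  the piece (REGᴸ) `LabelRegularityP … sb dI dB sb₁ dI₁ dB₁ …` (TYPED, binders of (X2ᴸ′) verbatim) [ROUTINE · the Fréchet upgrade of (C2ᴸ)];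
* §4  the glue `labelLoadStepP_of_greenResponse` (PROVED);
* §5  the door `mildCoherentMoatCorePG_W2o` : (X1ᴸ′)(lam > 0) ∧ (REGᴸ) ∧ (GRᴸ)(0 ≤ Γ• < •₁) ∧ (KAᴸ′) ∧ (QL♯ᴸ′)(c > 0) ∧ (OGʰ′⋆)(g₀ > 0) ⟹ `[MCMC♮]`,
      and a dial example (inner radii `1/400`, `Γ = (3/2000, 1/1250, 1/500)`).

Same namespace as the docket; 2 `def` (`tubeGauge`, Prop piece `LabelRegularityP`) + 12 theorems + 1 example; 0 sorry; imports ZZZYOA only. [g96]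
-/

noncomputable section

open scoped BigOperators Classical InnerProductSpace RealInnerProductSpace NNReal Pointwise
open MeasureTheory Set Metric Filter Topology Function
open Literature.MathematicalPhysics.StatisticalMechanics (lennardJones interactionEnergy)

namespace Summit.AtomisticToContinuum.Crystallization.Theorems.ChartedZeroExcessLayeredLatticeLiouville

open Summit.AtomisticToContinuum.Crystallization.Theorems.ChartedPlanarOrderRigidityDoor (E3 IsClean)
open Summit.AtomisticToContinuum.Crystallization.Theorems.ChartedPlanarOrderDensityDichotomy (μS IsSep)
open Summit.AtomisticToContinuum.Crystallization.Theorems.ChartedPlanarOrderCleanScaleP (IsCleanP IsDoorSetP)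
open Summit.AtomisticToContinuum.Crystallization.Theorems.ChartedPlanarOrderMesoCut (LayeredHom EnvClose)
open Summit.AtomisticToContinuum.Crystallization.Theorems.ChartedPlanarOrderDoorLayeredOsc (IsTwoShellAffineGood)

/-! ### ZZZYO-1  From first-order strong convexity to an invertible Hessian (PROVED) -/

section Coercive

variable {V : Type*} [NormedAddCommGroup V] [NormedSpace ℝ V]

/-- ★ **GRADIENT MONOTONICITY ⟹ HESSIAN COERCIVITY.**  If `E` has gradient field `G` and Hessian field `Hs` on an open `U ⊆ T`, and `E` is
first-order strongly convex on `T` with modulus `lam` against a weight `D` dominating `τ² S v` along rays (the (X1) conclusion), then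
`2·lam·S v ≤ Hs x v v` on `U`: add the two convexity inequalities at `x` and `x + τ v`, divide by `τ > 0`, let `τ → 0⁺`. [this file, g96] -/
theorem hessian_coercive_of_strongConvexOn {E : V → ℝ} {G : V → (V →L[ℝ] ℝ)} {Hs : V → (V →L[ℝ] (V →L[ℝ] ℝ))}
    {T U : Set V} {lam : ℝ} {D : V → V → ℝ} {S : V → ℝ} (hlam : 0 ≤ lam)
    (hU : IsOpen U) (hUT : U ⊆ T) (hE : ∀ x ∈ U, HasFDerivAt E (G x) x) (hG : ∀ x ∈ U, HasFDerivAt G (Hs x) x)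
    (hSC : ∀ z ∈ T, ∃ φ : V →L[ℝ] ℝ, HasFDerivAt E φ z ∧ ∀ z' ∈ T, E z + φ (z' - z) + lam * D z z' ≤ E z')
    (hD : ∀ (x v : V) (τ : ℝ), τ ^ 2 * S v ≤ D x (x + τ • v)) (hD' : ∀ (x v : V) (τ : ℝ), τ ^ 2 * S v ≤ D (x + τ • v) x) :
    ∀ x ∈ U, ∀ v : V, 2 * lam * S v ≤ (Hs x v) v := by
  intro x hx v
  have hc : ∀ τ : ℝ, HasDerivAt (fun τ : ℝ => x + τ • v) v τ := fun τ => by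
    simpa using ((hasDerivAt_id τ).smul_const v).const_add x
  have hGx : HasFDerivAt G (Hs x) (x + (0 : ℝ) • v) := by simpa using hG x hx
  have hg : HasDerivAt (fun τ : ℝ => (G (x + τ • v)) v) ((Hs x v) v) 0 := by
    have h1 : HasDerivAt (fun τ : ℝ => G (x + τ • v)) (Hs x v) 0 := hGx.comp_hasDerivAt (0 : ℝ) (hc 0)
    exact ((ContinuousLinearMap.apply ℝ ℝ v).hasFDerivAt).comp_hasDerivAt (0 : ℝ) h1
  have hlim := hg.tendsto_slope_zero_right
  have hmemU : ∀ᶠ τ : ℝ in 𝓝[>] 0, x + τ • v ∈ U := by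
    have hcont : Continuous (fun τ : ℝ => x + τ • v) := continuous_const.add (continuous_id.smul continuous_const)
    have ht : Tendsto (fun τ : ℝ => x + τ • v) (𝓝 0) (𝓝 x) := by
      have h0 := hcont.tendsto 0
      simpa using h0
    exact (ht.eventually (hU.mem_nhds hx)).filter_mono nhdsWithin_le_nhds
  have hslope : ∀ᶠ τ : ℝ in 𝓝[>] 0,
      2 * lam * S v ≤ τ⁻¹ • ((G (x + (0 + τ) • v)) v - (G (x + (0 : ℝ) • v)) v) := by
    filter_upwards [hmemU, self_mem_nhdsWithin] with τ hτU hτ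
    have hτ : 0 < τ := hτ
    obtain ⟨φ, hφ, hsc⟩ := hSC x (hUT hx)
    obtain ⟨φ', hφ', hsc'⟩ := hSC (x + τ • v) (hUT hτU)
    have e1 : φ = G x := hφ.unique (hE x hx)
    have e2 : φ' = G (x + τ • v) := hφ'.unique (hE _ hτU)
    have i1 := hsc (x + τ • v) (hUT hτU)
    have i2 := hsc' x (hUT hx)
    have hd1 := mul_le_mul_of_nonneg_left (hD x v τ) hlam
    have hd2 := mul_le_mul_of_nonneg_left (hD' x v τ) hlam
    rw [e1] at i1
    rw [e2] at i2
    have a1 : (G x) (x + τ • v - x) = τ * (G x) v := by rw [add_sub_cancel_left, map_smul, smul_eq_mul]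
    have a2 : (G (x + τ • v)) (x - (x + τ • v)) = -(τ * (G (x + τ • v)) v) := by
      rw [show x - (x + τ • v) = -(τ • v) by abel, map_neg, map_smul, smul_eq_mul]
    rw [a1] at i1
    rw [a2] at i2
    have key : 2 * lam * S v * τ ≤ (G (x + τ • v)) v - (G x) v := by
      have h3 : τ * (2 * lam * S v * τ) ≤ τ * ((G (x + τ • v)) v - (G x) v) := by nlinarith
      exact le_of_mul_le_mul_left h3 hτ
    simp only [zero_add, zero_smul, add_zero, smul_eq_mul]
    calc 2 * lam * S v = τ⁻¹ * (2 * lam * S v * τ) := by field_simp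
      _ ≤ τ⁻¹ * ((G (x + τ • v)) v - (G x) v) := mul_le_mul_of_nonneg_left key (inv_nonneg.mpr hτ.le)
  exact ge_of_tendsto hlim hslope

/-- an injective `A : V →L (V →L ℝ)` on a finite-dimensional `V` is a continuous linear equivalence onto the dual (dimension count
`finrank (V →L ℝ) = finrank V`; the endomorphism version is the tree's `Literature.Topology.FourManifolds.exists_continuousLinearEquiv_eq_of_injective`).
[this file, g96] -/
theorem exists_dualEquiv_eq_of_injective [FiniteDimensional ℝ V] (A : V →L[ℝ] (V →L[ℝ] ℝ))
    (hA : Function.Injective A) : ∃ e : V ≃L[ℝ] (V →L[ℝ] ℝ), (e : V →L[ℝ] (V →L[ℝ] ℝ)) = A := by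
  have hrank : Module.finrank ℝ V = Module.finrank ℝ (V →L[ℝ] ℝ) := by
    rw [← (LinearMap.toContinuousLinearMap : (V →ₗ[ℝ] ℝ) ≃ₗ[ℝ] (V →L[ℝ] ℝ)).finrank_eq]
    exact (Subspace.dual_finrank_eq).symm
  exact ⟨(LinearEquiv.ofInjectiveOfFinrankEq (A : V →ₗ[ℝ] (V →L[ℝ] ℝ)) hA hrank).toContinuousLinearEquiv, by ext v w; rfl⟩

end Coercive

/-! ### ZZZYO-2  The gauge set of tube increments (bookkeeping, PROVED) -/

section Gauge

variable {n : ℕ} {X : Set E3} {Rg : ℝ} {y₀ : Fin n → E3}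

/-- **THE TUBE GAUGE SET** `tubeGauge X Rg Γb ΓI ΓB y₀`: the increments `c` whose re-based image `c + y₀` lies in the bond tube `T(Γb, ΓI, ΓB)` about `y₀`
— bond differences `‖c i − c j‖ ≤ Γb` on the `Rg`-pairs of the reference, interface pin `‖c i‖ ≤ ΓI`, bulk pin `‖c i‖ ≤ ΓB`.  An intersection of
seminorm balls: closed, convex, symmetric, `0 ∈` for nonnegative radii, positively homogeneous in the radii. [this file, g96] -/
def tubeGauge (X : Set E3) (Rg Γb ΓI ΓB : ℝ) {n : ℕ} (y₀ : Fin n → E3) : Set (Fin n → E3) :=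
  {c | (fun i => c i + y₀ i) ∈ bondTube X Rg Γb ΓI ΓB y₀}

variable {Γb ΓI ΓB : ℝ}

/-- membership in the gauge set, unfolded to norms. [this file, g96] -/
theorem mem_tubeGauge_iff {c : Fin n → E3} : c ∈ tubeGauge X Rg Γb ΓI ΓB y₀ ↔
    (∀ i j, dist (y₀ i) (y₀ j) ≤ Rg → ‖c i - c j‖ ≤ Γb) ∧ (∀ i, (∃ p ∈ X, dist (y₀ i) p ≤ Rg) → ‖c i‖ ≤ ΓI) ∧ ∀ i, ‖c i‖ ≤ ΓB := by
  have e1 : ∀ i j, dist (c i + y₀ i - (c j + y₀ j)) (y₀ i - y₀ j) = ‖c i - c j‖ := fun i j => by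
    rw [dist_eq_norm]; congr 1; abel
  have e2 : ∀ i, dist (c i + y₀ i) (y₀ i) = ‖c i‖ := fun i => by rw [dist_eq_norm, add_sub_cancel_right]
  simp only [tubeGauge, mem_setOf_eq, mem_bondTube_iff, e1, e2]

/-- the gauge set is convex. [this file, g96] -/
theorem convex_tubeGauge : Convex ℝ (tubeGauge X Rg Γb ΓI ΓB y₀) :=
  (convex_bondTube (X := X) (Rg := Rg) (sb := Γb) (dI := ΓI) (dB := ΓB) (y₀ := y₀)).translate_preimage_left y₀

/-- the gauge set is closed. [this file, g96] -/
theorem isClosed_tubeGauge : IsClosed (tubeGauge X Rg Γb ΓI ΓB y₀) :=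
  (isClosed_bondTube (X := X) (Rg := Rg) (sb := Γb) (dI := ΓI) (dB := ΓB) (y₀ := y₀)).preimage (continuous_id.add continuous_const)

/-- `0` lies in the gauge set of nonnegative radii. [this file, g96] -/
theorem zero_mem_tubeGauge (hb : 0 ≤ Γb) (hI : 0 ≤ ΓI) (hB : 0 ≤ ΓB) : (0 : Fin n → E3) ∈ tubeGauge X Rg Γb ΓI ΓB y₀ := by
  refine mem_tubeGauge_iff.2 ⟨fun i j _ => ?_, fun i _ => ?_, fun i => ?_⟩ <;> simpa

/-- the gauge set is monotone in its radii. [this file, g96] -/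
theorem tubeGauge_mono {Γb' ΓI' ΓB' : ℝ} (hb : Γb ≤ Γb') (hI : ΓI ≤ ΓI') (hB : ΓB ≤ ΓB') :
    tubeGauge X Rg Γb ΓI ΓB y₀ ⊆ tubeGauge X Rg Γb' ΓI' ΓB' y₀ := fun _ hc => bondTube_mono hb hI hB hc

/-- positive homogeneity: `μ • c` lies in the gauge set of radii `|μ|·Γ`. [this file, g96] -/
theorem smul_mem_tubeGauge {c : Fin n → E3} (hc : c ∈ tubeGauge X Rg Γb ΓI ΓB y₀) (μ : ℝ) :
    μ • c ∈ tubeGauge X Rg (|μ| * Γb) (|μ| * ΓI) (|μ| * ΓB) y₀ := by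
  obtain ⟨h1, h2, h3⟩ := mem_tubeGauge_iff.1 hc
  refine mem_tubeGauge_iff.2 ⟨fun i j hij => ?_, fun i hi => ?_, fun i => ?_⟩
  · rw [Pi.smul_apply, Pi.smul_apply, ← smul_sub, norm_smul, Real.norm_eq_abs]
    exact mul_le_mul_of_nonneg_left (h1 i j hij) (abs_nonneg μ)
  · rw [Pi.smul_apply, norm_smul, Real.norm_eq_abs]
    exact mul_le_mul_of_nonneg_left (h2 i hi) (abs_nonneg μ)
  · rw [Pi.smul_apply, norm_smul, Real.norm_eq_abs]
    exact mul_le_mul_of_nonneg_left (h3 i) (abs_nonneg μ)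

/-- a step by a gauge-set increment: `z ∈ T(a)`, `z′ − z ∈ tubeGauge(b)` ⟹ `z′ ∈ T(a + b)` (`bondTube_step`). [this file, g96] -/
theorem mem_bondTube_of_sub_mem_tubeGauge {a₁ a₂ a₃ : ℝ} {z z' : Fin n → E3} (hz : z ∈ bondTube X Rg a₁ a₂ a₃ y₀)
    (hd : z' - z ∈ tubeGauge X Rg Γb ΓI ΓB y₀) : z' ∈ bondTube X Rg (a₁ + Γb) (a₂ + ΓI) (a₃ + ΓB) y₀ :=
  bondTube_step hz hd

/-- a sup-norm ball about a tube member: `closedBall z δ ⊆ T(a_b + 2δ, a_I + δ, a_B + δ)` (`mem_bondTube_of_norm_sub_le`). [this file, g96] -/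
theorem closedBall_subset_bondTube {a₁ a₂ a₃ δ' : ℝ} {z : Fin n → E3} (hz : z ∈ bondTube X Rg a₁ a₂ a₃ y₀) :
    closedBall z δ' ⊆ bondTube X Rg (a₁ + 2 * δ') (a₂ + δ') (a₃ + δ') y₀ := fun w hw =>
  mem_bondTube_of_norm_sub_le hz (by rwa [mem_closedBall, dist_eq_norm] at hw)

end Gauge

/-! ### ZZZYO-3  The piece (REGᴸ) `LabelRegularityP` (TYPED; binders of (X2ᴸ′) verbatim) -/

section Pieces

/-- ★★ **(REGᴸ) «LabelRegularityP … ϑ₀ Rg sb dI dB sb₁ dI₁ dB₁ …» — `C²` FRÉCHET REGULARITY OF THE CLAMPED ENERGY BETWEEN THE TUBES.**  Binders of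
(X2ᴸ′) `LabelLoadedTubeAprioriP` VERBATIM up to the free-tube-reference clause; conclusion: there is an OPEN set `W` with `T(sb₁, dI₁, dB₁) ⊆ W ⊆
T(sb, dI, dB)` (inner tube inside, outer tube outside) on which `E = clampedEnergy (S ∖ core)` has a gradient field `G` (`HasFDerivAt E (G x) x`)
and a Hessian field `Hs` (`HasFDerivAt G (Hs x) x`) of class `C¹`, whose polarisation is the tree's pre-stressed Hessian form:
`2·Hs x v w = Q_x(v + w) − Q_x v − Q_x w`, `Q_x = clampedHessForm (S ∖ core) x` (tree ZZZYJ).  ROUTINE-type (the members of the outer tube are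
collision-free fillings off the `δ`-separated exterior, where the Lennard-Jones lattice sums are smooth with locally uniformly convergent derivative
series; the polarisation identity is the symmetry of `D²E` plus `Q_x v = D²E(x)(v,v)`) · the Fréchet upgrade of the chord calculus (C2ᴸ)
`ChordCalculusP` of tree ZZZYK (which differentiates only along chords) · requires `sb₁ < sb`, `dI₁ < dI`, `dB₁ < dB` strictly (true at the record
dials: `4 sb₁ ≤ sb`, `4 dI₁ ≤ dI`, `dB₁ ≤ 2/5 < 21/50`).
Why it might fail: only by mis-typing — a tube member with a collision or an exterior contact (excluded by `IsFreeTubeReference` and the pins), or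
the inner radii not strictly inside the outer ones.
Sources: tree ZZZYJ (`clampedHessForm`, `bondHess`), tree ZZZYK (C2ᴸ) docstring, tree YV (Gl♯) `PlacedPerfectResponseP` (twice-differentiability
of `clampedEnergy` at the placed perfect patch); [EhrlacherOrtnerShapeev2016, §2.2.2 extension theorem (2): the energy-difference functional is `k`
times continuously Fréchet differentiable on the OPEN admissible set — arXiv:1306.5334 p. 6], adapted there from [OrtnerTheil2012]. [this file, g96] -/
def LabelRegularityP (ϑc ϑ ϑp r rΘ q rsh ρ rm σ ϑr Rs ε rI ℓ ϑ₀ Rg sb dI dB sb₁ dI₁ dB₁ aHi Λ θ s : ℝ) : Prop :=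
  ∀ δ : ℝ, 0 < δ → ∀ a : ℝ, 0 < a →
    ∀ S : Set E3, IsDoorSetP aHi δ S → (∀ z : E3, Summable fun y : S => lennardJones (dist z (y : E3))) →
      (∀ p ∈ S, IsTwoShellAffineGood θ S p) →
        ∀ (L : E3 ≃L[ℝ] E3) (w : ℤ → E3), IsEquilChart a s Λ L w →
          ∀ (x₀ : E3) (K : Set E3), K ⊆ S → (∀ k ∈ K, dist k x₀ ≤ q) →
            IsTameOn ϑp S (LayeredHom (L : E3 →L[ℝ] E3) w) (coreOf S K rm) →
              IsTameOn ϑc S (LayeredHom (L : E3 →L[ℝ] E3) w) (moatIn S K r (r + rsh)) →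
                ∀ (n : ℕ) (xf : Fin n → E3), Function.Injective xf → Set.range xf = coreOf S K ρ →
                  ∀ (L' : E3 →L[ℝ] E3) (w' : ℤ → E3) (U : E3 ≃ₗᵢ[ℝ] E3) (t : E3),
                    IsCoolShadowCrystal σ ϑr Rs ε r rI ℓ S K (LayeredHom (L : E3 →L[ℝ] E3) w) L' w' U t →
                      ∀ lab : E3 → E3, IsBondLabel ε rΘ ℓ S K (placedCrystal L' w' U t) lab →
                        IsFreeTubeReference ϑ₀ ϑ Rg sb dI dB (S \ coreOf S K ρ) (LayeredHom (L : E3 →L[ℝ] E3) w) (fun i => lab (xf i)) →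
                          ∃ W : Set (Fin n → E3), IsOpen W ∧ bondTube (S \ coreOf S K ρ) Rg sb₁ dI₁ dB₁ (fun i => lab (xf i)) ⊆ W ∧
                            W ⊆ bondTube (S \ coreOf S K ρ) Rg sb dI dB (fun i => lab (xf i)) ∧
                              ∃ (G : (Fin n → E3) → ((Fin n → E3) →L[ℝ] ℝ)) (Hs : (Fin n → E3) → ((Fin n → E3) →L[ℝ] ((Fin n → E3) →L[ℝ] ℝ))),
                                (∀ x ∈ W, HasFDerivAt (fun z : Fin n → E3 => clampedEnergy (S \ coreOf S K ρ) z) (G x) x) ∧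
                                  (∀ x ∈ W, HasFDerivAt G (Hs x) x) ∧ ContDiffOn ℝ 1 Hs W ∧
                                    ∀ x ∈ W, ∀ v v' : Fin n → E3,
                                      2 * (Hs x v) v' = clampedHessForm (S \ coreOf S K ρ) x (v + v') -
                                        clampedHessForm (S \ coreOf S K ρ) x v - clampedHessForm (S \ coreOf S K ρ) x v'

end Pieces

/-! ### ZZZYO-4  The glue: (X1ᴸ′)(lam > 0) ∧ (REGᴸ) ∧ (GRᴸ)(Γ) ∧ [Γ·h < η] ⟹ (LSᴸ)(η, h) by the load ramp (PROVED) -/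

section Glue

variable {ϑc ϑ ϑp r rΘ q rsh ρ rm σ ϑr Rs ε rI ℓ ϑ₀ Rg sb dI dB sb₁ dI₁ dB₁ ηb ηI ηB Γb ΓI ΓB h lam aHi Λ θ s : ℝ}

/-- ★★★ **THE DAVIDENKO GLUE (PROVED): (X1ᴸ′)(lam > 0) ∧ (REGᴸ) ∧ (GRᴸ)(Γb, ΓI, ΓB) ⟹ (LSᴸ)(ηb, ηI, ηB, h)** whenever `Γ•·h < η•` (strictly),
`Γ• ≥ 0`, `h ≥ 0`, `dB₁ ≥ 0`.  From a critical point `z ∈ T(•₁ − η)` at load `t₁`, run the load ramp `exists_loadRamp` with `ψ = (t₁ − s₁)·φ₀`,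
gauge `tubeGauge(|s₁ − t₁|·Γ)`, response region `Kr = T(•₁)` (compact), `U = W` of (REGᴸ): the Hessian is invertible on `W` by
`hessian_coercive_of_strongConvexOn` (from (X1ᴸ′)) + `exists_dualEquiv_eq_of_injective`; the Newton direction lies in the gauge by
(GRᴸ) + the polarisation clause of (REGᴸ); the envelope `z + [0,1]•gauge + ball(δ₀)` stays in `T(•₁)` because `|s₁ − t₁|·Γ• + 2δ₀ ≤ h·Γ• + 2δ₀ ≤ η•`.
The end point `x₁` has `G x₁ = (1 − t₁)φ₀ + (t₁ − s₁)φ₀ = (1 − s₁)φ₀` and increment in `tubeGauge(η)`.  NO generic Green-operator norm, NO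
Hessian–Lipschitz constant, NO step-size condition. [this file, g96] -/
theorem labelLoadStepP_of_greenResponse (hlam : 0 < lam) (hh : 0 ≤ h) (hdB₁ : 0 ≤ dB₁)
    (hΓb : 0 ≤ Γb) (hΓI : 0 ≤ ΓI) (hΓB : 0 ≤ ΓB) (hmb : Γb * h < ηb) (hmI : ΓI * h < ηI) (hmB : ΓB * h < ηB)
    (hC : LabelTubeConvexityP ϑc ϑ ϑp r rΘ q rsh ρ rm σ ϑr Rs ε rI ℓ ϑ₀ Rg sb dI dB lam aHi Λ θ s)
    (hR : LabelRegularityP ϑc ϑ ϑp r rΘ q rsh ρ rm σ ϑr Rs ε rI ℓ ϑ₀ Rg sb dI dB sb₁ dI₁ dB₁ aHi Λ θ s)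
    (hGR : LabelGreenResponseP ϑc ϑ ϑp r rΘ q rsh ρ rm σ ϑr Rs ε rI ℓ ϑ₀ Rg sb dI dB sb₁ dI₁ dB₁ Γb ΓI ΓB aHi Λ θ s) :
    LabelLoadStepP ϑc ϑ ϑp r rΘ q rsh ρ rm σ ϑr Rs ε rI ℓ ϑ₀ Rg sb dI dB sb₁ dI₁ dB₁ ηb ηI ηB h aHi Λ θ s := by
  intro δ hδ a ha S hS hsum hgood L w hLw x₀ K hKS hKq hmild hcool n xf hxf hrange L' w' U t hCr lab hlab hy₀ φ₀ hφ₀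
    t₁ s₁ ht₀ ht₁ hs₀ hs₁ hst z hz hzc
  have hSC := hC δ hδ a ha S hS hsum hgood L w hLw x₀ K hKS hKq hmild hcool n xf hxf hrange L' w' U t hCr lab hlab hy₀
  obtain ⟨W, hWo, hW₁, hWT, G, Hs, hE, hG, hHs, hpol⟩ :=
    hR δ hδ a ha S hS hsum hgood L w hLw x₀ K hKS hKq hmild hcool n xf hxf hrange L' w' U t hCr lab hlab hy₀
  have hresp := hGR δ hδ a ha S hS hsum hgood L w hLw x₀ K hKS hKq hmild hcool n xf hxf hrange L' w' U t hCr lab hlab hy₀ φ₀ hφ₀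
  set Xc : Set E3 := S \ coreOf S K ρ with hXc
  set y₀ : Fin n → E3 := fun i => lab (xf i) with hy₀def
  -- constants of the ramp
  set μ : ℝ := |s₁ - t₁| with hμ
  have hμ0 : 0 ≤ μ := abs_nonneg _
  have hμΓb : μ * Γb ≤ Γb * h := by rw [mul_comm]; exact mul_le_mul_of_nonneg_left hst hΓb
  have hμΓI : μ * ΓI ≤ ΓI * h := by rw [mul_comm]; exact mul_le_mul_of_nonneg_left hst hΓI
  have hμΓB : μ * ΓB ≤ ΓB * h := by rw [mul_comm]; exact mul_le_mul_of_nonneg_left hst hΓB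
  have hηb : 0 ≤ ηb := ((mul_nonneg hΓb hh).trans hmb.le)
  have hηI : 0 ≤ ηI := ((mul_nonneg hΓI hh).trans hmI.le)
  have hηB : 0 ≤ ηB := ((mul_nonneg hΓB hh).trans hmB.le)
  set δ₀ : ℝ := min ((ηb - Γb * h) / 2) (min (ηI - ΓI * h) (ηB - ΓB * h)) with hδ₀def
  have hδ₀ : 0 < δ₀ := lt_min (by linarith) (lt_min (by linarith) (by linarith))
  have hδb : 2 * δ₀ ≤ ηb - Γb * h := by have := min_le_left ((ηb - Γb * h) / 2) (min (ηI - ΓI * h) (ηB - ΓB * h)); linarith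
  have hδI : δ₀ ≤ ηI - ΓI * h := (min_le_right _ _).trans (min_le_left _ _)
  have hδB : δ₀ ≤ ηB - ΓB * h := (min_le_right _ _).trans (min_le_right _ _)
  -- the tubes
  have hT₁W : bondTube Xc Rg sb₁ dI₁ dB₁ y₀ ⊆ W := hW₁
  have hzT₁ : z ∈ bondTube Xc Rg sb₁ dI₁ dB₁ y₀ := bondTube_mono (by linarith) (by linarith) (by linarith) hz
  have hzW : z ∈ W := hT₁W hzT₁
  -- invertibility of the Hessian on W, from (X1ᴸ′)
  have hcoer : ∀ x ∈ W, ∀ v : Fin n → E3, 2 * lam * (∑ i, ‖v i‖ ^ 2) ≤ (Hs x v) v := by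
    refine hessian_coercive_of_strongConvexOn (E := fun z : Fin n → E3 => clampedEnergy Xc z) (T := bondTube Xc Rg sb dI dB y₀)
      (D := fun z z' : Fin n → E3 => ∑ i, dist (z i) (z' i) ^ 2) (S := fun v : Fin n → E3 => ∑ i, ‖v i‖ ^ 2)
      hlam.le hWo hWT hE hG hSC (fun x v τ => le_of_eq ?_) (fun x v τ => le_of_eq ?_)
    · rw [Finset.mul_sum]; refine Finset.sum_congr rfl fun i _ => ?_
      rw [Pi.add_apply, Pi.smul_apply, dist_eq_norm, show x i - (x i + τ • v i) = -(τ • v i) by abel, norm_neg, norm_smul,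
        Real.norm_eq_abs, mul_pow, sq_abs]
    · rw [Finset.mul_sum]; refine Finset.sum_congr rfl fun i _ => ?_
      rw [Pi.add_apply, Pi.smul_apply, dist_eq_norm, add_sub_cancel_left, norm_smul, Real.norm_eq_abs, mul_pow, sq_abs]
  have hinv : ∀ x ∈ W, ∃ e : (Fin n → E3) ≃L[ℝ] ((Fin n → E3) →L[ℝ] ℝ), (e : (Fin n → E3) →L[ℝ] ((Fin n → E3) →L[ℝ] ℝ)) = Hs x := by
    intro x hx
    refine exists_dualEquiv_eq_of_injective (Hs x) ((injective_iff_map_eq_zero _).2 fun v hv => ?_)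
    have h1 := hcoer x hx v
    rw [hv, zero_apply] at h1
    have h2 : ∑ i, ‖v i‖ ^ 2 ≤ 0 := by nlinarith
    have h3 : ∀ i, ‖v i‖ ^ 2 = 0 := fun i =>
      (Finset.sum_eq_zero_iff_of_nonneg (fun j _ => sq_nonneg (‖v j‖))).1 (le_antisymm h2 (Finset.sum_nonneg fun j _ => sq_nonneg _)) i
        (Finset.mem_univ i)
    funext i
    have := h3 i
    rwa [sq_eq_zero_iff, norm_eq_zero] at this
  -- the gauge and the structured response
  set C : Set (Fin n → E3) := tubeGauge Xc Rg (μ * Γb) (μ * ΓI) (μ * ΓB) y₀ with hCdef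
  have hrespC : ∀ x ∈ bondTube Xc Rg sb₁ dI₁ dB₁ y₀, ∃ v ∈ C, Hs x v = (t₁ - s₁) • φ₀ := by
    intro x hx
    obtain ⟨u, hu, hpolu⟩ := hresp x hx
    have hHu : Hs x u = φ₀ := by
      ext v'
      have h1 := hpol x (hT₁W hx) u v'
      have h2 := hpolu v'
      linarith
    refine ⟨(t₁ - s₁) • u, ?_, by rw [map_smul, hHu]⟩
    have h3 := smul_mem_tubeGauge (show u ∈ tubeGauge Xc Rg Γb ΓI ΓB y₀ from hu) (t₁ - s₁)
    rwa [abs_sub_comm] at h3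
  -- the envelope of the ramp stays in the inner tube with margin δ₀
  have henv : ∀ σ' ∈ Icc (0 : ℝ) 1, ∀ c ∈ C, closedBall (z + σ' • c) δ₀ ⊆ bondTube Xc Rg sb₁ dI₁ dB₁ y₀ := by
    intro σ' hσ' c hc
    have h1 : σ' • c ∈ tubeGauge Xc Rg (μ * Γb) (μ * ΓI) (μ * ΓB) y₀ := by
      have h2 := smul_mem_tubeGauge hc σ'
      rw [abs_of_nonneg hσ'.1] at h2
      exact tubeGauge_mono (mul_le_of_le_one_left (mul_nonneg hμ0 hΓb) hσ'.2) (mul_le_of_le_one_left (mul_nonneg hμ0 hΓI) hσ'.2)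
        (mul_le_of_le_one_left (mul_nonneg hμ0 hΓB) hσ'.2) h2
    have h3 : z + σ' • c ∈ bondTube Xc Rg (sb₁ - ηb + μ * Γb) (dI₁ - ηI + μ * ΓI) (dB₁ - ηB + μ * ΓB) y₀ :=
      mem_bondTube_of_sub_mem_tubeGauge hz (by rwa [add_sub_cancel_left])
    exact (closedBall_subset_bondTube h3).trans (bondTube_mono (by linarith) (by linarith) (by linarith))
  -- run the ramp over σ ∈ [0, 1]
  obtain ⟨x₁, hx₁C, hGx₁⟩ := exists_loadRamp (V := Fin n → E3) hWo hT₁W (isCompact_bondTube hdB₁) hG hHs hinv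
    convex_tubeGauge isClosed_tubeGauge (zero_mem_tubeGauge (mul_nonneg hμ0 hΓb) (mul_nonneg hμ0 hΓI) (mul_nonneg hμ0 hΓB))
    hrespC zero_le_one hδ₀ henv 1 ⟨zero_le_one, le_rfl⟩
  rw [one_smul] at hx₁C hGx₁
  have hGz : G z = (1 - t₁) • φ₀ := (hE z hzW).unique hzc
  have hx₁T₁ : x₁ ∈ bondTube Xc Rg sb₁ dI₁ dB₁ y₀ :=
    bondTube_mono (by linarith) (by linarith) (by linarith) (mem_bondTube_of_sub_mem_tubeGauge hz hx₁C)
  refine ⟨x₁, tubeGauge_mono (by linarith) (by linarith) (by linarith) hx₁C, ?_⟩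
  have h1 := hE x₁ (hT₁W hx₁T₁)
  rw [hGx₁, hGz, ← add_smul, show 1 - t₁ + (t₁ - s₁) = 1 - s₁ by ring] at h1
  exact h1

end Glue

/-! ### ZZZYO-5  The door W2o at the record dials and a dial example -/

section Door

/-- ★★ **THE DOOR W2o**: `ϑc ≤ 5·10⁻¹²`, (X1ᴸ′)(lam > 0), (REGᴸ), (GRᴸ)(Γb, ΓI, ΓB) with `0 ≤ Γ• < •₁` (the uniform linear response gauge
STRICTLY INSIDE the inner radii), (KAᴸ′), (QL♯ᴸ′)(c > 0), (OGʰ′⋆)(g₀ > 0), W2m ceilings — ⟹ `[MCMC♮](ϑc)`.  Door W2n with `m` steps,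
`η• = •₁/(m+1)` and `m > Γ•/(•₁ − Γ•)` (Archimedes), its (LSᴸ) hypothesis discharged by `labelLoadStepP_of_greenResponse`. [this file, g96] -/
theorem mildCoherentMoatCorePG_W2o {ϑc sb₁ dI₁ dB₁ sbp dIp dBp Γb ΓI ΓB lam c g₀ : ℝ}
    (hϑc : ϑc ≤ 1 / 200000000000) (hlam : 0 < lam) (hc : 0 < c) (hg₀ : 0 < g₀)
    (hsb : 4 * sb₁ ≤ 249 / 5000) (hdI : 4 * dI₁ ≤ 249 / 5000) (hdB : dB₁ ≤ 2 / 5)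
    (hΓb : 0 ≤ Γb) (hΓI : 0 ≤ ΓI) (hΓB : 0 ≤ ΓB) (hΓsb : Γb < sb₁) (hΓdI : ΓI < dI₁) (hΓdB : ΓB < dB₁)
    (hX1 : LabelTubeConvexityP ϑc tameRadius (1 / 10) 8 (145 / 16) 4 12 16 16 (27 / 32) (1 / 10000) 5 (1 / 10000) 10 (43 / 2) (1 / 5000) (121 / 25)
      (249 / 5000) (249 / 5000) (21 / 50) lam 1 2 (1 / 16) (1 / 50))
    (hREG : LabelRegularityP ϑc tameRadius (1 / 10) 8 (145 / 16) 4 12 16 16 (27 / 32) (1 / 10000) 5 (1 / 10000) 10 (43 / 2) (1 / 5000) (121 / 25)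
      (249 / 5000) (249 / 5000) (21 / 50) sb₁ dI₁ dB₁ 1 2 (1 / 16) (1 / 50))
    (hGR : LabelGreenResponseP ϑc tameRadius (1 / 10) 8 (145 / 16) 4 12 16 16 (27 / 32) (1 / 10000) 5 (1 / 10000) 10 (43 / 2) (1 / 5000) (121 / 25)
      (249 / 5000) (249 / 5000) (21 / 50) sb₁ dI₁ dB₁ Γb ΓI ΓB 1 2 (1 / 16) (1 / 50))
    (hKA : SoftCaptureP ϑc (1 / 10) 8 (145 / 16) 4 12 16 16 (27 / 32) (1 / 10000) 5 (1 / 10000) 10 (43 / 2) (121 / 25) sb₁ dI₁ dB₁ sbp dIp dBp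
      (121 / 25) (249 / 10000) 1 2 (1 / 16) (1 / 50))
    (hQS : SoftLedgerSharpP ϑc tameRadius (1 / 10) 8 (145 / 16) 4 12 16 16 (27 / 32) (1 / 10000) 5 (1 / 10000) 10 (43 / 2) (121 / 25) sb₁ dI₁ dB₁
      sbp dIp dBp (121 / 25) (249 / 10000) c 1 2 (1 / 16) (1 / 50))
    (hH : OffTubeHardGapMinP ϑc tameRadius (1 / 10) 8 (145 / 16) 4 12 16 16 (27 / 32) (1 / 10000) 5 (1 / 10000) 10 (43 / 2) (121 / 25) (249 / 5000)
      (249 / 5000) (21 / 50) sb₁ dI₁ dB₁ (121 / 25) (249 / 10000) g₀ 1 2 (1 / 16) (1 / 50)) :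
    MildCoherentMoatCorePG ϑc tameRadius (1 / 10) 8 4 12 16 1 2 (1 / 16) (1 / 50) := by
  obtain ⟨m, hm⟩ := exists_nat_gt (max (Γb / (sb₁ - Γb)) (max (ΓI / (dI₁ - ΓI)) (ΓB / (dB₁ - ΓB))))
  have hb' : Γb / (sb₁ - Γb) < m := (le_max_left _ _).trans_lt hm
  have hI' : ΓI / (dI₁ - ΓI) < m := ((le_max_left _ _).trans (le_max_right _ _)).trans_lt hm
  have hB' : ΓB / (dB₁ - ΓB) < m := ((le_max_right _ _).trans (le_max_right _ _)).trans_lt hm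
  have hm' : (0 : ℝ) < m := (div_nonneg hΓb (sub_pos.2 hΓsb).le).trans_lt hb'
  have hm0 : 0 < m := by exact_mod_cast hm'
  have hm1 : (0 : ℝ) < m + 1 := by linarith
  rw [div_lt_iff₀ (sub_pos.2 hΓsb)] at hb'
  rw [div_lt_iff₀ (sub_pos.2 hΓdI)] at hI'
  rw [div_lt_iff₀ (sub_pos.2 hΓdB)] at hB'
  have hdB₀ : 0 ≤ dB₁ := hΓB.trans hΓdB.le
  have kb : Γb * (1 / (m : ℝ)) < sb₁ / (m + 1) := by
    rw [mul_one_div, div_lt_div_iff₀ hm' hm1]; nlinarith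
  have kI : ΓI * (1 / (m : ℝ)) < dI₁ / (m + 1) := by
    rw [mul_one_div, div_lt_div_iff₀ hm' hm1]; nlinarith
  have kB : ΓB * (1 / (m : ℝ)) < dB₁ / (m + 1) := by
    rw [mul_one_div, div_lt_div_iff₀ hm' hm1]; nlinarith
  exact mildCoherentMoatCorePG_W2n (ηb := sb₁ / (m + 1)) (ηI := dI₁ / (m + 1)) (ηB := dB₁ / (m + 1)) hm0 hϑc hlam hc hg₀ hsb hdI hdB
    (div_nonneg (hΓb.trans hΓsb.le) hm1.le) (div_nonneg (hΓI.trans hΓdI.le) hm1.le) (div_nonneg hdB₀ hm1.le)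
    (by rw [mul_div_cancel₀ _ hm1.ne']) (by rw [mul_div_cancel₀ _ hm1.ne']) (by rw [mul_div_cancel₀ _ hm1.ne']) hX1
    (labelLoadStepP_of_greenResponse hlam (by positivity) hdB₀ hΓb hΓI hΓB kb kI kB hX1 hREG hGR) hKA hQS hH

/-- **DIAL EXAMPLE** (E2's reading, memo §1: adversarial structured response `Γb ≤ 1.5·10⁻³`, `ΓI ≤ 8·10⁻⁴` at the record dials; bulk `ΓB`
taken `2·10⁻³`): with the inner tube of record `(sb₁, dI₁, dB₁) = (1/400, 1/400, 1/400)` every arithmetic side condition of door W2o holds —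
the load ramp needs exactly `Γ• < •₁`. [this file, g96] -/
example : (4 : ℝ) * (1 / 400) ≤ 249 / 5000 ∧ (1 / 400 : ℝ) ≤ 2 / 5 ∧ (0 : ℝ) ≤ 3 / 2000 ∧ (3 / 2000 : ℝ) < 1 / 400 ∧
    (0 : ℝ) ≤ 1 / 1250 ∧ (1 / 1250 : ℝ) < 1 / 400 ∧ (0 : ℝ) ≤ 1 / 500 ∧ (1 / 500 : ℝ) < 1 / 400 := by
  refine ⟨by norm_num, by norm_num, by norm_num, by norm_num, by norm_num, by norm_num, by norm_num, by norm_num⟩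

end Door

end Summit.AtomisticToContinuum.Crystallization.Theorems.ChartedZeroExcessLayeredLatticeLiouville
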